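import Summits.BirchSwinnertonDyer.Rank1Residual.Additive.KummerVersusUnramifiedLocal
import Literature.NumberTheory.EllipticCurves.TateParametrisationTorsion
import Literature.NumberTheory.EllipticCurves.KodairaNeronUnramifiedInertiaProofs
import Literature.NumberTheory.GaloisRepresentations.UnramifiedKummer
import HarnessLib

/-!
# At a Tate place with `p ∣ ord(q)` the rational point `Φ(ϖ)` has NO inertia-fixed `p`-th root
# (cell `b2b-bsdres`, team n1011, seat p16 GEN 4; row T-BUD5-K = FILE 5 K-GENERAL of the budget
# programme T-E3g-BUD0 / BUDn (n1011-p10), r2 ROUTE-2 §II.17.3 D-n.3 (mult); skeleton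
# `cells/n1011/skel/T-BUD5-K.md`, step 4, TATE ROUTE)

HONEST FRAMING (cell `b2b-bsdres`, run/shared/lean/b2b/bsd-rank1-residual/, verbatim in every
file): the goal of the cell is to DELETE the COMBINATION-SHAPED residual classes of the
Birch–Swinnerton-Dyer formula for ALL analytic-rank `≤ 1` elliptic curves over `ℚ` — "full BSD
formula for every rank `≤ 1` curve in class `C`" assembled STRICTLY from published theorems — so
that the rank-`≤ 1` remainder becomes exactly the CONSTRUCTION-SHAPED classes, which are TYPED
(missing-input `Prop`s), NOT attempted. This is not "finishing BSD". Team n1011 (N10 / N11, the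
Route-G budget node): research route; no claim beyond the stated classes; nothing is booked; marks
UNCHANGED. Theorems only: no definition, no named fact, no `sorry`; the Tate parametrisation enters
as EXPLICIT HYPOTHESES (the shape of the named fact `Silverman1994_thmV53_tateUniformisation`, as in
`TateParametrisationTorsion.lean`), so nothing here is conditional.

## What and why

The Tamagawa-place input of n1011-p10's budget assembly is, per place `v ∤ p`, ONE unramified class
of `H¹(K_v, E[p])` outside the local Kummer condition `𝓚_v`; by `KummerVersusUnramifiedLocal.lean`
(this seat, steps 1–3) it suffices to produce a rational point `P ∈ E(K_v)` NONE of whose `p`-th roots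
in `E(K̄_v)` is fixed by the inertia group `I_{K_v}`. At a place of split multiplicative reduction
this is Tate-curve arithmetic (Silverman *ATAEC* V.3–V.5; Greenberg LNM 1716 p. 74: at a split
multiplicative `v ∤ p` the local kernel `ker r_v` has order `c_v^{(p)}`): with a Tate parametrisation
`Φ : K̄_v^* → E(K̄_v)` (kernel `q^ℤ`, `Γ_{K_v}`-equivariant, surjective) and a uniformiser `ϖ`, the
rational point `P = Φ(ϖ)` has `p`-th roots `Φ(x)` with `x^p = ϖ q^m`; if `p ∣ ord(q)` then
`ord(x^p) ≡ 1 (mod p)`, so `x ∉ K_v^{nr}` (the maximal unramified extension has the value group of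
`K_v`: `exists_algNorm_eq_zpow_of_mem_maxUnramified`), i.e. some `τ ∈ I_{K_v}` moves `x`, and then
`τ` moves `Φ(x)` (a `Γ`-translate of `x` with the same image differs from `x` by a power of `q` that
is also a `p`-th root of unity, hence trivial: `zpow_algebraMap_eq_one_imp`).

* `mem_maxUnramified_of_forall_absInertia` — an element of `K̄_v` fixed by every `τ ∈ absInertia K_v`
  lies in `maxUnramified K_v` (Galois correspondence; the `absInertia` form of the tree's
  `mem_maxUnramified_iff_forall_inertia`).
* `exists_point_forall_root_not_fixed_of_tateData` — **for Tate data `(q, Φ)` at `v` with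
  `q = u · r^p`, `|u|_v = 1` ("`p ∣ ord_v(q)`"): some `P ∈ E(K_v)` has no inertia-fixed `p`-th root.**
* `exists_mem_unramifiedSubgroup_not_mem_kummerLocalConditionAt_of_tateData` — hence, at such a place
  `v ∤ p`, **`∃ u ∈ H¹_ur(K_v, E[p])` with `u ∉ 𝓚_v`** — n1011-p10's Tamagawa-witness binder
  (`KummerVersusUnramifiedLocal.exists_mem_unramifiedSubgroup_not_mem_kummerLocalConditionAt_of_forall_root`).

LOCATED GAP (not claimed here; said plainly): the census / Kodaira datum at a split multiplicative
place is `p ∣ c_v = ord_v(Δ_min) = −ord_v(j)`; that THIS equals `ord_v(q)` for the `q` of Tate's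
uniformisation (Silverman *ATAEC* V.3.1 (b) `j(E_q) = 1/q + 744 + …`, V.5.3, with Cor. IV.9.2 (d)) is
NOT in the tree (the named fact `Silverman1994_thmV53_tateUniformisation` records `0 < |q|_v < 1`
only). The hypothesis `hpq` below is therefore stated on `q` itself.

References: J. H. Silverman, *ATAEC*, GTM 151, V.3.1, V.5.3, IV.9.2; R. Greenberg, LNM 1716 (1999)
p. 74; J.-P. Serre, *Local Fields*, IV §4 Prop. 16 and Cor. 2; J. Neukirch, *ANT*, II (9.11).
-/

noncomputable section

open scoped Classical

namespace WeierstrassCurve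

open Literature.NumberTheory.EllipticCurves Literature.NumberTheory.GaloisRepresentations Field
open Literature.NumberTheory.GaloisRepresentations.IsNonarchimedeanLocalField
open NumberField IsDedekindDomain ValuativeRel

section Local

variable {K : Type} [Field K] [NumberField K] (W : WeierstrassCurve K)
  {p : ℕ} [hp : Fact p.Prime] (v : HeightOneSpectrum (𝓞 K))

omit hp in
/-- **An element of `K̄_v` fixed by the inertia group lies in the maximal unramified extension**
(`absInertia` form of the tree's `mem_maxUnramified_iff_forall_inertia`: `I_{K_v} = Aut(K̄_v/K_v^{nr})`,
`mem_absInertia_iff_forall_mem_maxUnramified`, and the Galois correspondence for `K̄_v/K_v`,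
Mathlib `InfiniteGalois.fixedField_fixingSubgroup`). Neukirch, *ANT*, II (9.11).
[cite: NeukirchANT1999, Ch. II Def. (9.10) and Prop. (9.11)] -/
theorem mem_maxUnramified_of_forall_absInertia {x : AlgebraicClosure (v.adicCompletion K)}
    (h : ∀ τ ∈ absInertia (v.adicCompletion K), τ • x = x) :
    x ∈ maxUnramified (v.adicCompletion K) := by
  haveI := IsDedekindDomain.HeightOneSpectrum.isGalois_algebraicClosure_adicCompletion (v := v)
  have hfix : x ∈ IntermediateField.fixedField
      (maxUnramified (v.adicCompletion K)).fixingSubgroup := by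
    rw [IntermediateField.mem_fixedField_iff]
    intro f hf
    have hσ : (absoluteGaloisGroup.toAlgEquiv (v.adicCompletion K)).symm f ∈
        absInertia (v.adicCompletion K) := by
      rw [mem_absInertia_iff_forall_mem_maxUnramified]
      intro y hy
      exact (IntermediateField.mem_fixingSubgroup_iff _ _).mp hf y hy
    have := h _ hσ
    simpa using this
  rwa [InfiniteGalois.fixedField_fixingSubgroup] at hfix

/-- **At a Tate place with `p ∣ ord_v(q)`, the rational point `Φ(ϖ)` has no inertia-fixed `p`-th
root.** Let `(q, Φ)` be Tate data for `E = W` at the finite place `v` — `q ∈ K_v`, `0 < |q|_v < 1`,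
`Φ : K̄_v^* → E(K̄_v)` a surjective `Γ_{K_v}`-equivariant homomorphism with kernel `q^ℤ` (the
conclusion of `Silverman1994_thmV53_tateUniformisation`, taken as hypotheses) — and assume
`q = u · r^p` with `|u|_v = 1` (i.e. `p ∣ ord_v(q)`). Then there is a `K_v`-rational point `P`
(namely `Φ(ϖ)` for a uniformiser `ϖ`, read in `E(K_v)` through `e = baseChangeGeomPointsEquiv`) such
that EVERY `Q ∈ E(K̄_v)` with `p • Q = e(P)` is moved by some element of the inertia group
`absInertia K_v`. (If `Q = Φ(x)` were inertia-fixed then `x` would be: a `Γ`-translate `τx` with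
`Φ(τx) = Φ(x)` is `x q^k` with `(q^k)^p = τ(x^p)/x^p = 1`, so `k = 0`; hence `x ∈ K_v^{nr}` has
`|x| ∈ |ϖ|^ℤ`, contradicting `|x|^p = |ϖ| · |r|^{pm}`.) With `KummerVersusUnramifiedLocal`'s
`exists_mem_unramifiedSubgroup_not_mem_kummerLocalConditionAt_of_forall_root` this is the Tamagawa
witness `∃ u ∈ H¹_ur(K_v, E[p]), u ∉ 𝓚_v` of the budget programme at such a place.
[cite: SilvermanATAEC1994, Ch. V Thm. 3.1 (c),(d) and Thm. 5.3 (a),(b)]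
[cite: GreenbergLNM1716, §3 p. 74] [cite: SerreLocalFields1979, Ch. IV §4 Prop. 16 and Cor. 2] -/
theorem exists_point_forall_root_not_fixed_of_tateData
    {q : v.adicCompletion K} (hq0 : q ≠ 0) (hq1 : Valued.v q < 1)
    (Φ : Additive (AlgebraicClosure (v.adicCompletion K))ˣ →+ localPoints W (v.adicCompletion K))
    (hsurj : Function.Surjective Φ)
    (hker : ∀ u : (AlgebraicClosure (v.adicCompletion K))ˣ, Φ (Additive.ofMul u) = 0 ↔ ∃ n : ℤ,
        (u : AlgebraicClosure (v.adicCompletion K)) =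
          algebraMap (v.adicCompletion K) (AlgebraicClosure (v.adicCompletion K)) q ^ n)
    (hequiv : ∀ (σ : absoluteGaloisGroup (v.adicCompletion K))
        (u : (AlgebraicClosure (v.adicCompletion K))ˣ),
      σ • Φ (Additive.ofMul u) =
        Φ (Additive.ofMul (Units.map (absoluteGaloisGroup.toAlgEquiv _ σ :
          AlgebraicClosure (v.adicCompletion K) →* _) u)))
    (hpq : ∃ (u : (𝒪[v.adicCompletion K])ˣ) (r : v.adicCompletion K),
      q = ((u : 𝒪[v.adicCompletion K]) : v.adicCompletion K) * r ^ p) :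
    ∃ P : (W.baseChange (v.adicCompletion K)).toAffine.Point,
      ∀ Q : localPoints W (v.adicCompletion K),
        (p : ℤ) • Q = W.baseChangeGeomPointsEquiv (v.adicCompletion K)
            (toGeomPoints (W.baseChange (v.adicCompletion K)) P) →
          ∃ τ ∈ absInertia (v.adicCompletion K), τ • Q ≠ Q := by
  haveI : CharZero (v.adicCompletion K) := charZero_adicCompletion v
  have hpp : p.Prime := hp.out
  have hιinj : Function.Injective
      (algebraMap (v.adicCompletion K) (AlgebraicClosure (v.adicCompletion K))) :=
    (algebraMap (v.adicCompletion K) (AlgebraicClosure (v.adicCompletion K))).injective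
  set qb : AlgebraicClosure (v.adicCompletion K) :=
    algebraMap (v.adicCompletion K) (AlgebraicClosure (v.adicCompletion K)) q with hqb
  -- a uniformiser `ϖ` of `𝒪[K_v]` and the rational point `P₀ = Φ(ϖ)`
  obtain ⟨ϖ, hϖ⟩ := IsDiscreteValuationRing.exists_irreducible (𝒪[v.adicCompletion K])
  set ϖb : AlgebraicClosure (v.adicCompletion K) :=
    algebraMap (𝒪[v.adicCompletion K]) (AlgebraicClosure (v.adicCompletion K)) ϖ with hϖb
  have hϖb' : ϖb = algebraMap (v.adicCompletion K) (AlgebraicClosure (v.adicCompletion K))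
      ((ϖ : 𝒪[v.adicCompletion K]) : v.adicCompletion K) :=
    IsScalarTower.algebraMap_apply (𝒪[v.adicCompletion K]) (v.adicCompletion K)
      (AlgebraicClosure (v.adicCompletion K)) ϖ
  have hϖb0 : ϖb ≠ 0 := (algNorm_pos_iff.mp (algNorm_uniformizer_pos hϖ))
  set P₀ : localPoints W (v.adicCompletion K) := Φ (Additive.ofMul (Units.mk0 ϖb hϖb0)) with hP₀
  -- `Γ_{K_v}` fixes `ϖ`, so `P₀` is `Γ_{K_v}`-fixed, hence `K_v`-rational
  have hP₀fix : ∀ σ : absoluteGaloisGroup (v.adicCompletion K), σ • P₀ = P₀ := fun σ => by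
    rw [hP₀, hequiv]
    congr 2
    refine Units.ext ?_
    change (absoluteGaloisGroup.toAlgEquiv (v.adicCompletion K) σ) ϖb = ϖb
    rw [hϖb', AlgEquiv.commutes]
  have hfixX : (W.baseChangeGeomPointsEquiv (v.adicCompletion K)).symm P₀ ∈
      MulAction.fixedPoints (absoluteGaloisGroup (v.adicCompletion K))
        (geomPoints (W.baseChange (v.adicCompletion K))) := fun σ => by
    rw [← baseChangeGeomPointsEquiv_symm_smul, hP₀fix σ]
  obtain ⟨P, hP⟩ :=
    (mem_range_toGeomPoints_iff (W.baseChange (v.adicCompletion K)) _).mpr hfixX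
  refine ⟨P, fun Q hQ => ?_⟩
  rw [hP, AddEquiv.apply_symm_apply] at hQ
  -- suppose every element of the inertia group fixes `Q`
  by_contra hcon
  have hQfix : ∀ τ ∈ absInertia (v.adicCompletion K), τ • Q = Q := fun τ hτ => by
    by_contra hne
    exact hcon ⟨τ, hτ, hne⟩
  -- `Q = Φ(x)` with `x^p = ϖ q^m`
  obtain ⟨y, rfl⟩ := hsurj Q
  have hy : y = Additive.ofMul (Additive.toMul y) := (ofMul_toMul y).symm
  set x : (AlgebraicClosure (v.adicCompletion K))ˣ := Additive.toMul y with hx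
  rw [hy] at hQ hQfix
  have hxp : Φ (Additive.ofMul (x ^ (p : ℤ) * (Units.mk0 ϖb hϖb0)⁻¹)) = 0 := by
    rw [ofMul_mul, ofMul_inv, ofMul_zpow, map_add, map_neg, map_zsmul, hQ, hP₀, add_neg_cancel]
  obtain ⟨m, hm⟩ := (hker _).mp hxp
  have hx0 : (x : AlgebraicClosure (v.adicCompletion K)) ≠ 0 := x.ne_zero
  have hxpow : (x : AlgebraicClosure (v.adicCompletion K)) ^ p = ϖb * qb ^ m := by
    have h1 : ((x ^ (p : ℤ) * (Units.mk0 ϖb hϖb0)⁻¹ : (AlgebraicClosure (v.adicCompletion K))ˣ) :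
        AlgebraicClosure (v.adicCompletion K)) = (x : AlgebraicClosure (v.adicCompletion K)) ^ p * ϖb⁻¹ := by
      rw [Units.val_mul, Units.val_inv_eq_inv_val, Units.val_zpow_eq_zpow_val, zpow_natCast,
        Units.val_mk0]
    rw [h1] at hm
    calc (x : AlgebraicClosure (v.adicCompletion K)) ^ p
        = (x : AlgebraicClosure (v.adicCompletion K)) ^ p * ϖb⁻¹ * ϖb := by
          rw [mul_assoc, inv_mul_cancel₀ hϖb0, mul_one]
      _ = ϖb * qb ^ m := by rw [hm, hqb, mul_comm]
  -- every `τ ∈ I_{K_v}` fixes `x` itself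
  have hxfix : ∀ τ ∈ absInertia (v.adicCompletion K),
      τ • (x : AlgebraicClosure (v.adicCompletion K)) = x := by
    intro τ hτ
    have h1 : Φ (Additive.ofMul (Units.map (absoluteGaloisGroup.toAlgEquiv (v.adicCompletion K) τ :
        AlgebraicClosure (v.adicCompletion K) →* _) x * x⁻¹)) = 0 := by
      rw [ofMul_mul, ofMul_inv, map_add, map_neg, ← hequiv, hQfix τ hτ, add_neg_cancel]
    obtain ⟨k, hk⟩ := (hker _).mp h1
    have hτx : (absoluteGaloisGroup.toAlgEquiv (v.adicCompletion K) τ)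
        (x : AlgebraicClosure (v.adicCompletion K)) =
          (x : AlgebraicClosure (v.adicCompletion K)) * qb ^ k := by
      have h2 : ((Units.map (absoluteGaloisGroup.toAlgEquiv (v.adicCompletion K) τ :
          AlgebraicClosure (v.adicCompletion K) →* _) x * x⁻¹ :
            (AlgebraicClosure (v.adicCompletion K))ˣ) : AlgebraicClosure (v.adicCompletion K)) =
          (absoluteGaloisGroup.toAlgEquiv (v.adicCompletion K) τ)
            (x : AlgebraicClosure (v.adicCompletion K)) * (x : AlgebraicClosure (v.adicCompletion K))⁻¹ := by
        rw [Units.val_mul, Units.val_inv_eq_inv_val]; rfl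
      rw [h2, hqb] at hk
      calc (absoluteGaloisGroup.toAlgEquiv (v.adicCompletion K) τ) (x : AlgebraicClosure (v.adicCompletion K))
          = (absoluteGaloisGroup.toAlgEquiv (v.adicCompletion K) τ)
              (x : AlgebraicClosure (v.adicCompletion K)) *
              (x : AlgebraicClosure (v.adicCompletion K))⁻¹ * x := by
            rw [mul_assoc, inv_mul_cancel₀ hx0, mul_one]
        _ = (x : AlgebraicClosure (v.adicCompletion K)) * qb ^ k := by rw [hk, hqb, mul_comm]
    -- `(q^k)^p = τ(x^p)/x^p = 1`, so `k = 0`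
    have hfixp : (absoluteGaloisGroup.toAlgEquiv (v.adicCompletion K) τ)
        ((x : AlgebraicClosure (v.adicCompletion K)) ^ p) =
          (x : AlgebraicClosure (v.adicCompletion K)) ^ p := by
      rw [hxpow, map_mul, map_zpow₀, hϖb', hqb, AlgEquiv.commutes, AlgEquiv.commutes]
    have hxp0 : (x : AlgebraicClosure (v.adicCompletion K)) ^ p ≠ 0 := pow_ne_zero _ hx0
    have hqk : qb ^ (k * p) = 1 := by
      have h3 : ((absoluteGaloisGroup.toAlgEquiv (v.adicCompletion K) τ)
          (x : AlgebraicClosure (v.adicCompletion K))) ^ p =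
            (x : AlgebraicClosure (v.adicCompletion K)) ^ p := by
        rw [← map_pow]; exact hfixp
      rw [hτx, mul_pow, ← zpow_natCast (qb ^ k), ← zpow_mul] at h3
      have h4 : (x : AlgebraicClosure (v.adicCompletion K)) ^ p * qb ^ (k * (p : ℤ)) =
          (x : AlgebraicClosure (v.adicCompletion K)) ^ p * 1 := by rw [mul_one]; exact h3
      exact mul_left_cancel₀ hxp0 h4
    have hk0 : k * (p : ℤ) = 0 := by
      rw [hqb] at hqk
      exact zpow_algebraMap_eq_one_imp v hq0 hq1 hqk
    have hk00 : k = 0 := by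
      rcases mul_eq_zero.mp hk0 with h | h
      · exact h
      · exact absurd (by exact_mod_cast h : p = 0) hpp.ne_zero
    rw [absoluteGaloisGroup.smul_def, hτx, hk00, zpow_zero, mul_one]
  -- hence `x ∈ K_v^{nr}` and `|x| ∈ |ϖ|^ℤ`
  have hxmem : (x : AlgebraicClosure (v.adicCompletion K)) ∈ maxUnramified (v.adicCompletion K) :=
    mem_maxUnramified_of_forall_absInertia v hxfix
  obtain ⟨n, hn⟩ := exists_algNorm_eq_zpow_of_mem_maxUnramified hϖ hxmem hx0
  -- norms: `|x^p| = |ϖ|^{pn}` and `|x^p| = |ϖ| · |q|^m`, `|q| = |r|^p`, `|r| = |ϖ|^j`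
  obtain ⟨u, r, hqur⟩ := hpq
  set N := algNorm (v.adicCompletion K) ϖb with hN
  have hNpos : 0 < N := algNorm_uniformizer_pos hϖ
  have hN1 : N < 1 := algNorm_uniformizer_lt_one hϖ
  have hr0 : r ≠ 0 := by
    rintro rfl
    apply hq0
    rw [hqur, zero_pow hpp.ne_zero, mul_zero]
  obtain ⟨j, hj⟩ := exists_algNorm_algebraMap_eq_zpow hϖ hr0
  have hnormu : algNorm (v.adicCompletion K)
      (algebraMap (v.adicCompletion K) (AlgebraicClosure (v.adicCompletion K))
        ((u : 𝒪[v.adicCompletion K]) : v.adicCompletion K)) = 1 := by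
    have hcoe : algebraMap (𝒪[v.adicCompletion K]) (v.adicCompletion K) (u : 𝒪[v.adicCompletion K]) =
        ((u : 𝒪[v.adicCompletion K]) : v.adicCompletion K) := rfl
    rw [← hcoe, ← IsScalarTower.algebraMap_apply (𝒪[v.adicCompletion K]) (v.adicCompletion K)
      (AlgebraicClosure (v.adicCompletion K))]
    exact algNorm_algebraMap_unit u
  have hnormq : algNorm (v.adicCompletion K) qb = N ^ ((p : ℤ) * j) := by
    rw [hqb, hqur, map_mul, map_pow, algNorm_mul, algNorm_pow, hnormu, one_mul, hj, ← hϖb, ← hN,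
      ← zpow_natCast, ← zpow_mul, mul_comm]
  have hlhs : algNorm (v.adicCompletion K) ((x : AlgebraicClosure (v.adicCompletion K)) ^ p) =
      N ^ ((p : ℤ) * n) := by
    rw [algNorm_pow, hn, ← zpow_natCast, ← zpow_mul, mul_comm]
  have hrhs : algNorm (v.adicCompletion K) ((x : AlgebraicClosure (v.adicCompletion K)) ^ p) =
      N ^ (1 + (p : ℤ) * j * m) := by
    rw [hxpow, algNorm_mul, IsDedekindDomain.HeightOneSpectrum.algNorm_zpow', hnormq, ← zpow_mul,
      zpow_add₀ hNpos.ne', zpow_one, mul_assoc]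
  have hexp : (p : ℤ) * n = 1 + (p : ℤ) * j * m :=
    zpow_right_injective₀ hNpos hN1.ne (hlhs.symm.trans hrhs)
  have hdvd : (p : ℤ) ∣ 1 := ⟨n - j * m, by linear_combination -hexp⟩
  have hp1 : p = 1 := by exact_mod_cast Int.eq_one_of_dvd_one (by positivity) hdvd
  exact hpp.ne_one hp1

/-- **The Tamagawa witness at a Tate place with `p ∣ ord_v(q)`, `v ∤ p`**: for Tate data `(q, Φ)`
of `W` at `v` (the conclusion of `Silverman1994_thmV53_tateUniformisation`, as hypotheses) with
`q = u · r^p`, `|u|_v = 1`, there is an UNRAMIFIED class of `H¹(K_v, E[p])` OUTSIDE the local Kummer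
condition `𝓚_v` — literally the per-place binder `hwit` of n1011-p10's
`Additive.exists_addSubgroup_relaxedKummer` / `exists_finset_layerZero_of_tamagawaWitnesses`
(any number field `K`). Previous theorem + this seat's
`exists_mem_unramifiedSubgroup_not_mem_kummerLocalConditionAt_of_forall_root`
(`KummerVersusUnramifiedLocal.lean`). The link `ord_v(q) = c_v` to the Kodaira / Tamagawa datum
of the census is NOT supplied here (module docstring). [cite: GreenbergLNM1716, §3 p. 74 and Cor. 5.6 (proof)]
[cite: SilvermanATAEC1994, Ch. V Thm. 3.1 (c),(d) and Thm. 5.3 (a),(b)] -/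
theorem exists_mem_unramifiedSubgroup_not_mem_kummerLocalConditionAt_of_tateData [W.IsElliptic]
    (hpv : (p : 𝓞 K) ∉ v.asIdeal)
    {q : v.adicCompletion K} (hq0 : q ≠ 0) (hq1 : Valued.v q < 1)
    (Φ : Additive (AlgebraicClosure (v.adicCompletion K))ˣ →+ localPoints W (v.adicCompletion K))
    (hsurj : Function.Surjective Φ)
    (hker : ∀ u : (AlgebraicClosure (v.adicCompletion K))ˣ, Φ (Additive.ofMul u) = 0 ↔ ∃ n : ℤ,
        (u : AlgebraicClosure (v.adicCompletion K)) =
          algebraMap (v.adicCompletion K) (AlgebraicClosure (v.adicCompletion K)) q ^ n)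
    (hequiv : ∀ (σ : absoluteGaloisGroup (v.adicCompletion K))
        (u : (AlgebraicClosure (v.adicCompletion K))ˣ),
      σ • Φ (Additive.ofMul u) =
        Φ (Additive.ofMul (Units.map (absoluteGaloisGroup.toAlgEquiv _ σ :
          AlgebraicClosure (v.adicCompletion K) →* _) u)))
    (hpq : ∃ (u : (𝒪[v.adicCompletion K])ˣ) (r : v.adicCompletion K),
      q = ((u : 𝒪[v.adicCompletion K]) : v.adicCompletion K) * r ^ p) :
    ∃ u ∈ DiscreteGaloisModule.unramifiedSubgroup
        ((W.torsionGaloisModule (p : ℤ)).restrictField (v.adicCompletion K)) 1,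
      u ∉ W.kummerLocalConditionAt (p : ℤ) (v.adicCompletion K) := by
  obtain ⟨P, hP⟩ := W.exists_point_forall_root_not_fixed_of_tateData v hq0 hq1 Φ hsurj hker hequiv hpq
  exact W.exists_mem_unramifiedSubgroup_not_mem_kummerLocalConditionAt_of_forall_root v hpv P hP

end Local

end WeierstrassCurve

end
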